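import Summits.Ventures.GridStability.Bench.KUNDUR2ACSGDeg4AOwnVDeg4Nu4ibk3m1PpData23
import Literature.Computation.Certificates.GramSOSList
import HarnessLib
-- PORT cert/sos-5/emit_lean.py@aec66be82ed62442 / source cert/A/KUNDUR2A-CSG-deg4-A-ownV-deg4-nu4ibk3m1-pp.json sha256: 36c09ec489f469d09080d3070dd11696da37ce8d26561deee755fc53d4368fd8
-- estimated kernel time of this file's `decide`s: 66 s (emitter calibration 2026-08-26; RULING 8 budget 70 s per file)

/-!
# Ventures/GridStability — Bench/KUNDUR2ACSGDeg4AOwnVDeg4Nu4ibk3m1PpChk7.lean: L8 ROW-RANGE CHUNK EQUALITIES 7 of 7 of certificate file `KUNDUR2A-CSG-deg4-A-ownV-deg4-nu4ibk3m1-pp` (system KUNDUR2A-CSG, V degree 4, toolchain A)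

Kernel zero tests `isZero (normMS P_t − GramL.polyRange lo n)`
(Literature/Computation/Certificates/GramSOSList.lean, lane L8 of RULING 19 (5b)): the partial sums
shipped in the Data shards ARE the row ranges of the free Gram polynomial of certificate
`KUNDUR2A-CSG-deg4-A-ownV-deg4-nu4ibk3m1-pp`; theorems
`deg4_A_ownV_deg4_nu4ibk3m1_pp_Vdot_neg_chunk6`. Assembled into `GramL.ChunkEqs` in the proof file.
Estimated 66 s here. «algebraic inequalities certified; ROA inclusion pending Lyapunov/ lemma».
-/

namespace Summit.Ventures.GridStability.Bench.KUNDUR2ACSG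

open Literature.Computation.Certificates Literature.Computation.Certificates.SOS
open Literature.Computation.Certificates.SOS.Poly

/-! ### L8 row-range chunk equalities (`GramL.polyRange`, `decide +kernel`) -/

set_option maxHeartbeats 0 in
/-- L8 CHUNK EQUALITY 7/7 of `deg4_A_ownV_deg4_nu4ibk3m1_pp_Vdot_neg`: the shipped partial sum `deg4_A_ownV_deg4_nu4ibk3m1_pp_Vdot_neg_P6` IS the free block's Gram polynomial on rows 162–188 (`GramL.polyRange`; one `decide`). [folklore] -/
theorem deg4_A_ownV_deg4_nu4ibk3m1_pp_Vdot_neg_chunk6 :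
    isZero (Poly.add (Poly.normMS deg4_A_ownV_deg4_nu4ibk3m1_pp_Vdot_neg_P6) (Poly.neg (deg4_A_ownV_deg4_nu4ibk3m1_pp_Vdot_neg_freeL.polyRange 162 27))) = true := by
  decide +kernel

end Summit.Ventures.GridStability.Bench.KUNDUR2ACSG
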